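import Mathlib
import Summits.ValiantsHypothesis.ValiantsHypothesis.Theorems.LacunarySymmetroidMatrixDescartesFoldLawStubMorseRoots

/-!
# `MatrixDescartes` (stmt-ValiantsHypothesis-18050), line «definite-pair-fold-law» — stub `stub_morse`, part 2:
the Morse count for a family of real-rooted polynomials (level crossings ≤ branches + folds)

Abstract form of the line's `MorseInequality`.  Data: two families `ψ η : ℝ → ℝ[X]` with
`(ψ x)(t) = (η t)(x)` (the vertical and horizontal slices of one bivariate polynomial `Φ(x,t)`), such that for
every `x > 0` the slice `ψ x` has degree `m`, `m` distinct real roots, and a leading coefficient of constant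
sign.  Let `y_0(x) < … < y_{m-1}(x)` be the sorted roots (continuous in `x` by part 1).  A FOLD on branch `j` is
a point `(c, y_j(c))`, `c > 0`, with `(η_{y_j(c)})'(c) = 0` (i.e. `∂ₓΦ(c, y_j(c)) = 0`).

* `fold_of_extremum` — if `y_j` has a one-sided extremum at an interior point `c` of an interval then
  `(c, y_j(c))` is a fold.  Proof WITHOUT derivatives of `y_j`: otherwise `x ↦ Φ(x, Y)`, `Y = y_j(c)`, has a
  simple zero at `c` and changes sign, while the number of roots of `ψ x` above `Y` is the same slightly left
  and slightly right of `c` (continuity of the other branches + the extremum), so by the sign-parity lemma of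
  part 1 the sign of `Φ(x, Y)` is the same on both sides — contradiction.
* `exists_fold_between` — between two level-`1` crossings of `y_j` there is a fold on branch `j` (extreme value
  theorem + the above; the level set is assumed finite).
* `card_filter_pos_roots_le` — the positive roots of `η 1 = Φ(·,1)` number at most `m + #F` for any finite set
  `F ⊆ ℝ²` containing all folds (consecutive crossings on each branch give distinct folds, distinct branches give
  distinct points).

Helper mode (`--supports stmt-ValiantsHypothesis-18050`); no definitions.  Honest framing: bookkeeping towards
`stub_morse`; the law `stub_foldLaw`, Conjecture B, the crux `MatrixDescartes` and VP ≠ VNP are OPEN and NOT moved.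
-/

set_option linter.dupNamespace false

namespace Summit.ValiantsHypothesis.ValiantsHypothesis.Theorems.LacunarySymmetroidMatrixDescartes.FoldLaw.Morse

open Polynomial Filter Topology
open scoped BigOperators

/-- **Fold at a one-sided extremum of a branch** (the Rolle step, derivative-free).  See the module docstring. -/
theorem fold_of_extremum {ψ η : ℝ → ℝ[X]} {m : ℕ} {s : ℝ}
    (hψη : ∀ x t, (ψ x).eval t = (η t).eval x)
    (hdeg : ∀ x, 0 < x → (ψ x).natDegree = m)
    (hcard : ∀ x, 0 < x → (ψ x).roots.toFinset.card = m)
    (hlc : ∀ x, 0 < x → 0 < s * (ψ x).leadingCoeff)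
    {y : Fin m → ℝ → ℝ} (hmono : ∀ x, 0 < x → StrictMono fun j => y j x)
    (hmem : ∀ x, 0 < x → ∀ j, y j x ∈ (ψ x).roots.toFinset)
    (hcont : ∀ j, ContinuousOn (y j) (Set.Ioi 0))
    {j : Fin m} {lo hi c : ℝ} (hlo : 0 < lo) (hc : c ∈ Set.Ioo lo hi)
    (hext : (∀ x ∈ Set.Ioo lo hi, y j x ≤ y j c) ∨ (∀ x ∈ Set.Ioo lo hi, y j c ≤ y j x)) :
    (η (y j c)).derivative.eval c = 0 := by
  classical
  obtain ⟨hloc, hchi⟩ := hc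
  have hc0 : 0 < c := hlo.trans hloc
  have hroot : ∀ x, 0 < x → ∀ i, (ψ x).IsRoot (y i x) := fun x hx i =>
    (mem_roots'.1 (Multiset.mem_toFinset.1 (hmem x hx i))).2
  have hcA : ∀ x, 0 < x → ∀ i, ContinuousAt (y i) x := fun x hx i =>
    (hcont i).continuousAt (Ioi_mem_nhds hx)
  set Y := y j c with hYdef
  have hhc : (η Y).eval c = 0 := by rw [← hψη]; exact hroot c hc0 j
  by_contra hD
  set D := (η Y).derivative.eval c with hDdef
  -- (i) `x ↦ Φ(x, Y)` has a simple zero at `c`, hence changes sign there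
  have hder : HasDerivAt (fun x => (η Y).eval x) D c := (η Y).hasDerivAt c
  have hev1 : ∀ᶠ x in 𝓝[≠] c, 0 < D * ((η Y).eval x * (x - c)) := by
    have ht : Tendsto (fun x => D * slope (fun x => (η Y).eval x) c x) (𝓝[≠] c) (𝓝 (D * D)) :=
      (hasDerivAt_iff_tendsto_slope.1 hder).const_mul D
    filter_upwards [ht.eventually_const_lt (mul_self_pos.2 hD), self_mem_nhdsWithin] with x hx hxc
    have hxc' : x - c ≠ 0 := sub_ne_zero.2 hxc
    rw [slope_def_field, hhc, sub_zero] at hx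
    have : D * ((η Y).eval x * (x - c)) = D * ((η Y).eval x / (x - c)) * (x - c) ^ 2 := by
      field_simp
    rw [this]
    exact mul_pos hx (by positivity)
  -- (ii) the other branches stay on their side of `Y`; stay inside the interval
  have hev2 : ∀ᶠ x in 𝓝 c, ∀ i, (y i c < Y → y i x < Y) ∧ (Y < y i c → Y < y i x) := by
    refine eventually_all.2 fun i => Eventually.and ?_ ?_
    · by_cases hi : y i c < Y
      · exact ((hcA c hc0 i).eventually_lt continuousAt_const hi).mono fun x hx _ => hx
      · exact Eventually.of_forall fun x h => absurd h hi
    · by_cases hi : Y < y i c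
      · exact (continuousAt_const.eventually_lt (hcA c hc0 i) hi).mono fun x hx _ => hx
      · exact Eventually.of_forall fun x h => absurd h hi
  have hev3 : ∀ᶠ x in 𝓝 c, x ∈ Set.Ioo lo hi := Ioo_mem_nhds hloc hchi
  have hev : ∀ᶠ x in 𝓝[≠] c, 0 < D * ((η Y).eval x * (x - c)) ∧ (x ∈ Set.Ioo lo hi ∧
      ∀ i, (y i c < Y → y i x < Y) ∧ (Y < y i c → Y < y i x)) :=
    hev1.and ((hev3.and hev2).filter_mono nhdsWithin_le_nhds)
  obtain ⟨x₁, ⟨hx₁D, hx₁I, hx₁y⟩, hx₁c⟩ :=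
    ((hev.filter_mono (nhdsLT_le_nhdsNE c)).and self_mem_nhdsWithin).exists
  obtain ⟨x₂, ⟨hx₂D, hx₂I, hx₂y⟩, hx₂c⟩ :=
    ((hev.filter_mono (nhdsGT_le_nhdsNE c)).and self_mem_nhdsWithin).exists
  have hx₁c' : x₁ < c := hx₁c
  have hx₂c' : c < x₂ := hx₂c
  have hx₁0 : 0 < x₁ := hlo.trans hx₁I.1
  have hx₂0 : 0 < x₂ := hlo.trans hx₂I.1
  -- `Y` is not a root of `ψ x₁`, `ψ x₂`
  have hne₁ : (ψ x₁).eval Y ≠ 0 := by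
    rw [hψη]; intro h0; rw [h0, zero_mul, mul_zero] at hx₁D; exact lt_irrefl _ hx₁D
  have hne₂ : (ψ x₂).eval Y ≠ 0 := by
    rw [hψη]; intro h0; rw [h0, zero_mul, mul_zero] at hx₂D; exact lt_irrefl _ hx₂D
  -- (iii) the set of branches above `Y` is the same index set `P` on both sides of `c`
  obtain ⟨P, _inst, hP⟩ : ∃ (P : Fin m → Prop) (_ : DecidablePred P), ∀ x, 0 < x → x ∈ Set.Ioo lo hi →
      (ψ x).eval Y ≠ 0 → (∀ i, (y i c < Y → y i x < Y) ∧ (Y < y i c → Y < y i x)) →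
        ∀ i, (Y < y i x ↔ P i) := by
    rcases hext with hmax | hmin
    · refine ⟨fun i => j < i, inferInstance, fun x hx hxI _ hyc i => ⟨fun hYlt => ?_, fun hji => ?_⟩⟩
      · by_contra hle
        rcases (not_lt.1 hle).lt_or_eq with hlt | heq
        · have h1 := hmono x hx hlt
          have h2 := hmax x hxI
          exact absurd (lt_trans hYlt h1) (not_lt.2 h2)
        · rw [heq] at hYlt
          exact absurd hYlt (not_lt.2 (hmax x hxI))
      · have : Y < y i c := by rw [hYdef]; exact hmono c hc0 hji
        exact (hyc i).2 this
    · refine ⟨fun i => j ≤ i, inferInstance, fun x hx hxI hne hyc i => ⟨fun hYlt => ?_, fun hji => ?_⟩⟩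
      · by_contra hlt
        have h1 : y i c < Y := by rw [hYdef]; exact hmono c hc0 (not_le.1 hlt)
        exact absurd hYlt (not_lt.2 ((hyc i).1 h1).le)
      · rcases hji.lt_or_eq with hlt | heq
        · exact lt_of_le_of_lt (hmin x hxI) (hmono x hx hlt)
        · rw [← heq]
          have hle := hmin x hxI
          have hneq : y j x ≠ Y := fun h0 => hne (h0 ▸ hroot x hx j)
          exact lt_of_le_of_ne hle (Ne.symm hneq)
  have hN : ∀ x, 0 < x → x ∈ Set.Ioo lo hi → (ψ x).eval Y ≠ 0 →
      (∀ i, (y i c < Y → y i x < Y) ∧ (Y < y i c → Y < y i x)) →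
      ((ψ x).roots.toFinset.filter (fun r => Y < r)).card = (Finset.univ.filter P).card :=
    fun x hx hxI hne hyc =>
      card_filter_roots_eq (hcard x hx) (hmono x hx) (hmem x hx) Y P (hP x hx hxI hne hyc)
  -- (iv) sign bookkeeping: parity says `Φ(x₁,Y) Φ(x₂,Y) > 0`, the simple zero says `< 0`
  have hA₁ := eval_mul_leadingCoeff_mul_neg_one_pow_pos (hdeg x₁ hx₁0) (hcard x₁ hx₁0) hne₁
  have hA₂ := eval_mul_leadingCoeff_mul_neg_one_pow_pos (hdeg x₂ hx₂0) (hcard x₂ hx₂0) hne₂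
  rw [hN x₁ hx₁0 hx₁I hne₁ hx₁y] at hA₁
  rw [hN x₂ hx₂0 hx₂I hne₂ hx₂y] at hA₂
  rw [← hψη] at hx₁D hx₂D
  set a := (ψ x₁).eval Y with ha
  set b := (ψ x₂).eval Y with hb
  set σ : ℝ := (-1) ^ (Finset.univ.filter P).card with hσ
  have hσ0 : σ ≠ 0 := pow_ne_zero _ (by norm_num)
  have hl₁ := hlc x₁ hx₁0
  have hl₂ := hlc x₂ hx₂0
  have hs0 : s ≠ 0 := by rintro rfl; rw [zero_mul] at hl₁; exact lt_irrefl _ hl₁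
  have hlc₁ : (ψ x₁).leadingCoeff ≠ 0 := by
    intro h0; rw [h0, mul_zero] at hl₁; exact lt_irrefl _ hl₁
  have hlc₂ : (ψ x₂).leadingCoeff ≠ 0 := by
    intro h0; rw [h0, mul_zero] at hl₂; exact lt_irrefl _ hl₂
  have hab_pos : 0 < a * b := by
    have h := mul_pos (mul_pos hA₁ hA₂) (mul_pos hl₁ hl₂)
    have e : a * (ψ x₁).leadingCoeff * σ * (b * (ψ x₂).leadingCoeff * σ) *
        (s * (ψ x₁).leadingCoeff * (s * (ψ x₂).leadingCoeff)) =
        (a * b) * (σ * s * (ψ x₁).leadingCoeff * (ψ x₂).leadingCoeff) ^ 2 := by ring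
    rw [e] at h
    have hq : 0 < (σ * s * (ψ x₁).leadingCoeff * (ψ x₂).leadingCoeff) ^ 2 := by positivity
    exact (mul_pos_iff_of_pos_right hq).1 h
  have hab_neg : a * b < 0 := by
    have h := mul_pos hx₁D hx₂D
    have e : D * (a * (x₁ - c)) * (D * (b * (x₂ - c))) = -(a * b) * (D ^ 2 * ((c - x₁) * (x₂ - c))) := by
      ring
    rw [e] at h
    have hq : 0 < D ^ 2 * ((c - x₁) * (x₂ - c)) :=
      mul_pos (by positivity) (mul_pos (sub_pos.2 hx₁c') (sub_pos.2 hx₂c'))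
    exact neg_pos.1 ((mul_pos_iff_of_pos_right hq).1 h)
  exact absurd hab_neg (not_lt.2 hab_pos.le)

/-- **Rolle between two level crossings.**  If branch `j` takes the value `1` at `lo < hi` (`lo > 0`) and its
level-`1` set in `(0,∞)` is finite, some interior point of `(lo, hi)` carries a fold of branch `j`. -/
theorem exists_fold_between {ψ η : ℝ → ℝ[X]} {m : ℕ} {s : ℝ}
    (hψη : ∀ x t, (ψ x).eval t = (η t).eval x)
    (hdeg : ∀ x, 0 < x → (ψ x).natDegree = m)
    (hcard : ∀ x, 0 < x → (ψ x).roots.toFinset.card = m)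
    (hlc : ∀ x, 0 < x → 0 < s * (ψ x).leadingCoeff)
    {y : Fin m → ℝ → ℝ} (hmono : ∀ x, 0 < x → StrictMono fun j => y j x)
    (hmem : ∀ x, 0 < x → ∀ j, y j x ∈ (ψ x).roots.toFinset)
    (hcont : ∀ j, ContinuousOn (y j) (Set.Ioi 0))
    {j : Fin m} {lo hi : ℝ} (hlo : 0 < lo) (hlohi : lo < hi)
    (hZ : {x | 0 < x ∧ y j x = 1}.Finite) (hjlo : y j lo = 1) (hjhi : y j hi = 1) :
    ∃ c ∈ Set.Ioo lo hi, (η (y j c)).derivative.eval c = 0 := by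
  have hnc : ∃ x₁ ∈ Set.Ioo lo hi, y j x₁ ≠ 1 := by
    by_contra hall
    push Not at hall
    exact Set.Ioo_infinite hlohi (hZ.subset fun x hx => ⟨hlo.trans hx.1, hall x hx⟩)
  obtain ⟨x₁, hx₁, hne⟩ := hnc
  have hcontI : ContinuousOn (y j) (Set.Icc lo hi) := (hcont j).mono fun x hx => hlo.trans_le hx.1
  have hne' : (Set.Icc lo hi).Nonempty := Set.nonempty_Icc.2 hlohi.le
  rcases lt_or_gt_of_ne hne with hlt | hgt
  · obtain ⟨c, hcI, hcmin⟩ := isCompact_Icc.exists_isMinOn hne' hcontI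
    rw [isMinOn_iff] at hcmin
    have hcle : y j c ≤ y j x₁ := hcmin x₁ (Set.Ioo_subset_Icc_self hx₁)
    have hc_lo : c ≠ lo := fun h => by rw [h, hjlo] at hcle; exact absurd hlt (not_lt.2 hcle)
    have hc_hi : c ≠ hi := fun h => by rw [h, hjhi] at hcle; exact absurd hlt (not_lt.2 hcle)
    have hcIoo : c ∈ Set.Ioo lo hi :=
      ⟨lt_of_le_of_ne hcI.1 (Ne.symm hc_lo), lt_of_le_of_ne hcI.2 hc_hi⟩
    exact ⟨c, hcIoo, fold_of_extremum hψη hdeg hcard hlc hmono hmem hcont hlo hcIoo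
      (Or.inr fun x hx => hcmin x (Set.Ioo_subset_Icc_self hx))⟩
  · obtain ⟨c, hcI, hcmax⟩ := isCompact_Icc.exists_isMaxOn hne' hcontI
    rw [isMaxOn_iff] at hcmax
    have hcle : y j x₁ ≤ y j c := hcmax x₁ (Set.Ioo_subset_Icc_self hx₁)
    have hc_lo : c ≠ lo := fun h => by rw [h, hjlo] at hcle; exact absurd hgt (not_lt.2 hcle)
    have hc_hi : c ≠ hi := fun h => by rw [h, hjhi] at hcle; exact absurd hgt (not_lt.2 hcle)
    have hcIoo : c ∈ Set.Ioo lo hi :=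
      ⟨lt_of_le_of_ne hcI.1 (Ne.symm hc_lo), lt_of_le_of_ne hcI.2 hc_hi⟩
    exact ⟨c, hcIoo, fold_of_extremum hψη hdeg hcard hlc hmono hmem hcont hlo hcIoo
      (Or.inl fun x hx => hcmax x (Set.Ioo_subset_Icc_self hx))⟩

/-- **The Morse count** (abstract `MorseInequality`): the positive roots of `η 1 = Φ(·, 1)` number at most `m`
plus the number of folds, for any finite `F ⊆ ℝ²` (points as `Fin 2 → ℝ`) containing every fold
`(c, t)`, `c > 0`, `ψ_c(t) = 0`, `(η_t)'(c) = 0`. -/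
theorem card_filter_pos_roots_le {ψ η : ℝ → ℝ[X]} {m : ℕ} {s : ℝ}
    (hψη : ∀ x t, (ψ x).eval t = (η t).eval x)
    (hdeg : ∀ x, 0 < x → (ψ x).natDegree = m)
    (hcard : ∀ x, 0 < x → (ψ x).roots.toFinset.card = m)
    (hlc : ∀ x, 0 < x → 0 < s * (ψ x).leadingCoeff)
    {F : Set (Fin 2 → ℝ)} (hFfin : F.Finite)
    (hF : ∀ c t, 0 < c → (ψ c).IsRoot t → (η t).derivative.eval c = 0 → ![c, t] ∈ F) :
    ((η 1).roots.toFinset.filter (fun x => 0 < x)).card ≤ m + F.ncard := by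
  classical
  by_cases hη : η 1 = 0
  · simp [hη]
  obtain ⟨y, hy⟩ := exists_sortedRoots ψ (Set.Ioi 0) m (fun x hx => hcard x hx)
  have hmono : ∀ x, 0 < x → StrictMono fun j => y j x := fun x hx => (hy x hx).1
  have hmem : ∀ x, 0 < x → ∀ j, y j x ∈ (ψ x).roots.toFinset := fun x hx => (hy x hx).2.1
  have hsurj : ∀ x, 0 < x → ∀ r ∈ (ψ x).roots.toFinset, ∃ j, y j x = r := fun x hx => (hy x hx).2.2
  have hψ0 : ∀ x, 0 < x → ψ x ≠ 0 := by
    intro x hx h0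
    have := hlc x hx
    rw [h0, leadingCoeff_zero, mul_zero] at this
    exact lt_irrefl _ this
  have hroot : ∀ x, 0 < x → ∀ i, (ψ x).IsRoot (y i x) := fun x hx i =>
    (mem_roots'.1 (Multiset.mem_toFinset.1 (hmem x hx i))).2
  -- continuity of the branches (part 1)
  have hcont : ∀ j, ContinuousOn (y j) (Set.Ioi 0) := by
    intro j
    refine isOpen_Ioi.continuousOn_iff.2 fun x hx => ?_
    refine continuousAt_sortedRoots isOpen_Ioi (fun x hx => hdeg x hx) (fun x hx => hcard x hx) ?_
      (fun x hx => hmono x hx) (fun x hx => hmem x hx) hx j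
    intro x₀ _ t
    have : (fun x => (ψ x).eval t) = fun x => (η t).eval x := funext fun x => hψη x t
    rw [this]
    exact (η t).continuous.continuousAt
  -- the positive roots of `η 1` and the level-1 sets of the branches
  set R := (η 1).roots.toFinset.filter (fun x => 0 < x) with hR
  set Z : Fin m → Finset ℝ := fun j => R.filter (fun x => y j x = 1) with hZ
  have hmemR : ∀ x, x ∈ R ↔ 0 < x ∧ (η 1).IsRoot x := by
    intro x
    rw [hR, Finset.mem_filter, Multiset.mem_toFinset, mem_roots hη]
    tauto
  have hmemZ : ∀ j x, x ∈ Z j ↔ 0 < x ∧ y j x = 1 := by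
    intro j x
    rw [hZ, Finset.mem_filter, hmemR]
    constructor
    · rintro ⟨⟨hx, _⟩, h1⟩; exact ⟨hx, h1⟩
    · rintro ⟨hx, h1⟩
      refine ⟨⟨hx, ?_⟩, h1⟩
      rw [IsRoot, ← hψη, ← h1]
      exact hroot x hx j
  have hRsub : R ⊆ Finset.univ.biUnion Z := by
    intro x hx
    obtain ⟨hx0, hxr⟩ := (hmemR x).1 hx
    have h1 : (1:ℝ) ∈ (ψ x).roots.toFinset := by
      rw [Multiset.mem_toFinset, mem_roots (hψ0 x hx0), IsRoot, hψη]
      exact hxr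
    obtain ⟨j, hj⟩ := hsurj x hx0 1 h1
    exact Finset.mem_biUnion.2 ⟨j, Finset.mem_univ _, (hmemZ j x).2 ⟨hx0, hj⟩⟩
  have hZfin : ∀ j, {x | 0 < x ∧ y j x = 1}.Finite := fun j =>
    (Z j).finite_toSet.subset fun x hx => by simpa [hmemZ] using hx
  -- folds between consecutive crossings
  have hfold : ∀ j (i : Fin ((Z j).card - 1)), ∃ c,
      (Z j).orderEmbOfFin rfl ⟨i.1, by omega⟩ < c ∧ c < (Z j).orderEmbOfFin rfl ⟨i.1 + 1, by omega⟩ ∧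
        (η (y j c)).derivative.eval c = 0 := by
    intro j i
    set lo := (Z j).orderEmbOfFin rfl ⟨i.1, by omega⟩ with hlo
    set hi := (Z j).orderEmbOfFin rfl ⟨i.1 + 1, by omega⟩ with hhi
    have hloZ : lo ∈ Z j := Finset.orderEmbOfFin_mem _ _ _
    have hhiZ : hi ∈ Z j := Finset.orderEmbOfFin_mem _ _ _
    obtain ⟨hlo0, hlo1⟩ := (hmemZ j lo).1 hloZ
    obtain ⟨_, hhi1⟩ := (hmemZ j hi).1 hhiZ
    have hlohi : lo < hi := ((Z j).orderEmbOfFin rfl).strictMono (Fin.mk_lt_mk.2 (Nat.lt_succ_self _))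
    obtain ⟨c, hc, hcf⟩ := exists_fold_between hψη hdeg hcard hlc hmono hmem hcont hlo0 hlohi
      (hZfin j) hlo1 hhi1
    exact ⟨c, hc.1, hc.2, hcf⟩
  choose c hclo hchi hcf using hfold
  -- the injection of gaps into folds
  set g : (Σ j : Fin m, Fin ((Z j).card - 1)) → (Fin 2 → ℝ) := fun q => ![c q.1 q.2, y q.1 (c q.1 q.2)]
    with hg
  have hc0 : ∀ j i, 0 < c j i := by
    intro j i
    have hloZ : (Z j).orderEmbOfFin rfl ⟨i.1, by omega⟩ ∈ Z j := Finset.orderEmbOfFin_mem _ _ _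
    exact (((hmemZ j _).1 hloZ).1).trans (hclo j i)
  have hgF : ∀ q, g q ∈ F := fun q =>
    hF _ _ (hc0 q.1 q.2) (hroot _ (hc0 q.1 q.2) q.1) (hcf q.1 q.2)
  have hginj : Function.Injective g := by
    rintro ⟨j, i⟩ ⟨j', i'⟩ h
    have h0 : c j i = c j' i' := by
      have := congrFun h 0
      simpa [hg] using this
    have h1 : y j (c j i) = y j' (c j' i') := by
      have := congrFun h 1
      simpa [hg] using this
    rw [h0] at h1
    obtain rfl : j = j' := (hmono _ (hc0 j' i')).injective h1
    have hii' : i = i' := by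
      by_contra hne
      rcases lt_or_gt_of_ne hne with hlt | hlt
      · have h2 : (Z j).orderEmbOfFin rfl ⟨i.1 + 1, by omega⟩ ≤ (Z j).orderEmbOfFin rfl ⟨i'.1, by omega⟩ :=
          ((Z j).orderEmbOfFin rfl).monotone (Fin.mk_le_mk.2 (by exact_mod_cast hlt))
        have := hchi j i
        have := hclo j i'
        linarith
      · have h2 : (Z j).orderEmbOfFin rfl ⟨i'.1 + 1, by omega⟩ ≤ (Z j).orderEmbOfFin rfl ⟨i.1, by omega⟩ :=
          ((Z j).orderEmbOfFin rfl).monotone (Fin.mk_le_mk.2 (by exact_mod_cast hlt))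
        have := hchi j i'
        have := hclo j i
        linarith
    subst hii'
    rfl
  have hcount : ∑ j, ((Z j).card - 1) ≤ F.ncard := by
    have h1 : (Finset.univ.image g).card = Fintype.card (Σ j : Fin m, Fin ((Z j).card - 1)) := by
      rw [Finset.card_image_of_injective _ hginj, Finset.card_univ]
    have h2 : Finset.univ.image g ⊆ hFfin.toFinset := by
      intro p hp
      obtain ⟨q, _, rfl⟩ := Finset.mem_image.1 hp
      exact hFfin.mem_toFinset.2 (hgF q)
    have h3 := Finset.card_le_card h2
    rw [h1, Fintype.card_sigma] at h3
    simp only [Fintype.card_fin] at h3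
    rwa [Set.ncard_eq_toFinset_card F hFfin]
  -- assemble
  calc R.card ≤ (Finset.univ.biUnion Z).card := Finset.card_le_card hRsub
    _ ≤ ∑ j, (Z j).card := Finset.card_biUnion_le
    _ ≤ ∑ j, ((Z j).card - 1 + 1) := Finset.sum_le_sum fun j _ => by omega
    _ = (∑ j, ((Z j).card - 1)) + m := by
        rw [Finset.sum_add_distrib, Finset.sum_const, Finset.card_univ, Fintype.card_fin, smul_eq_mul,
          mul_one]
    _ ≤ F.ncard + m := by omega
    _ = m + F.ncard := by ring

end Summit.ValiantsHypothesis.ValiantsHypothesis.Theorems.LacunarySymmetroidMatrixDescartes.FoldLaw.Morse
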